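import Mathlib
import HarnessLib
import Summits.HubbardSuperconductivity.HubbardSuperconductivity.Theorems.KLProgrammeC4aSublevelCounting

/-!
# Route `KLProgramme` — crux C4a, S3 brick (B4)/(B5) «(B4)-ABS-BUBBLE», part 2: LAYER CAKE — the loop-angle integral of the propagator ENVELOPE
# `∫ dφ/max(t,|ē(φ)|)` from the sublevel counting of part 1: `≤ 2(b−a)/κ + (2N/c₁)·log⁺(κ/(2t))` (transversal) `+ 12N/√(c₂t)` (folds)

Cell `gate-hubbard-kl`, seat hubbard-kl-k3c3-p3 (g26; row «implicit-function / monotonicity route for μ(n)»).  Located brick for the (C)-closer lane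
hubbard-kl-c4a-1 (stub (C) `stub_twoLeg_curvature` of `KLRegimeEngineV17F2`, stmt-HubbardSuperconductivity-20437), C4A-PLAN §24.4–§24.6 (B4)/(B5),
HOME/hubbard-kl-k3c3-p3/B4-DIRECT-COUNT.md §2 («the absolute-bubble `L¹(dϑ)` bound») and B4-ABS-BUBBLE.md.  Sequel of `…C4aSublevelCounting` (the distribution
function of `|g|` under the first/second-order dichotomy).

* **`integral_inv_envelope_le_of_sublevel`** (CAVALIERI): `g` continuous, `t, κ > 0`, `vol{x ∈ [a,b] : |g x| < s} ≤ α·s + β·√s` for `0 < s ≤ κ/2` ⟹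
  `∫_{[a,b]} dx/max(t,|g x|) ≤ 2(b − a)/κ + α·log⁺(κ/(2t)) + 2β/√t`: by Mathlib's layer-cake formula `Integrable.integral_eq_integral_meas_lt`,
  `∫ f = ∫₀^{1/t} vol{|g| < 1/σ} dσ`; the levels `σ ≤ 2/κ` cost `≤ (b − a)` each, the levels `2/κ < σ < 1/t` cost `≤ α/σ + β/√σ`
  (`integral_inv_of_pos`, `integral_inv_sqrt`).
* **`integral_inv_envelope_le_of_dichotomy_one`**: `g ∈ C¹`, slope ceiling `L₁`, dichotomy `|g| ≤ κ → c₁ ≤ |g′|`, `N` cells (`(b − a)·2L₁ ≤ N·κ`) ⟹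
  `∫_{[a,b]} dx/max(t,|g x|) ≤ 2(b − a)/κ + (2N/c₁)·log⁺(κ/(2t))` — each crossing cell costs ONE LOGARITHM of `κ/t`, integrable against the level
  (`∫₀ log⁺(κ/e) de < ∞`): the transversal configurations (generic direct, umklapp-transversal).
* **`integral_inv_envelope_le_of_dichotomy_two`**: `g ∈ C²`, ceilings `L₁, L₂`, dichotomy `|g| ≤ κ → |g′| < c₁ → c₂ ≤ |g″|`, `N` cells ⟹
  `≤ 2(b − a)/κ + (4N/c₁)·log⁺(κ/(2t)) + 12N/√(c₂·t)` — fold cells (tangency (T), umklapp caustic (T_G)) cost `t^{−1/2}`, integrable against the level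
  (`∫₀ de/√e < ∞`).  Interval-integral (`∫ x in a..b`) forms of both.

With `t = max(m,|e|) ≥ |e|` (finer-line split) the level layer `∫ w(e)(A + B·log⁺(κ/|e|) + C/√|e|) de` is `n`-free for any bounded weight `w` on the band
window — part 4; the Cooper configuration (where no dichotomy holds at `e = 0`: exact nesting) is part 3.  Carrier-free; nothing about the Hubbard model's
sizes; nothing asserts (C), K3 or superconductivity.  References: Salmhofer, Renormalization (1999) §4.5.3 Lemma 4.10 / Cor. 4.11 (the one-loop volume
bound and `B_t(q) ≤ 2B₀²Q_O(2 + log(ε₀/‖q‖²))`: «the only place where the bubble can diverge is q = 0»), §4.6.2 [cite: Salmhofer1999]; FST II, CPAM 51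
(1998) §3 [cite: FeldmanSalmhoferTrubowitz1998]; BGM 2006 §2.4, App. A2 [cite: BenfattoGiulianiMastropietro2006]; Lieb–Loss, Analysis, Thm. 1.13 (layer cake).
-/

noncomputable section

namespace Summit.HubbardSuperconductivity.HubbardSuperconductivity.Theorems.C4a

set_option linter.dupNamespace false -- summit = problem name (single-conjunct summit), D-0017

open Real Set Filter MeasureTheory intervalIntegral
open scoped Topology ENNReal

/-! ## §3 Layer cake: the loop-angle integral of the envelope `1/max(t,|g|)` (§1–§2 are part 1) -/

section LayerCake

variable {g : ℝ → ℝ} {a b : ℝ}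

/-- The envelope `x ↦ (max t |g x|)⁻¹` is continuous for `g` continuous and `t > 0`. -/
theorem continuous_inv_envelope (hgc : Continuous g) {t : ℝ} (ht : 0 < t) : Continuous fun x => (max t |g x|)⁻¹ :=
  (continuous_const.max hgc.abs).inv₀ fun _ => (lt_max_of_lt_left ht).ne'

/-- The envelope is bounded by `1/t` and nonnegative. -/
theorem inv_envelope_le (g : ℝ → ℝ) {t : ℝ} (ht : 0 < t) (x : ℝ) : (max t |g x|)⁻¹ ≤ t⁻¹ :=
  inv_anti₀ ht (le_max_left _ _)

/-- The envelope is nonnegative. -/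
theorem inv_envelope_nonneg (g : ℝ → ℝ) {t : ℝ} (ht : 0 < t) (x : ℝ) : 0 ≤ (max t |g x|)⁻¹ :=
  inv_nonneg.2 (ht.le.trans (le_max_left _ _))

/-- The superlevel sets of the envelope are the sublevel sets of `|g|`: for `0 < σ < 1/t`, `σ < (max t |g x|)⁻¹ ↔ |g x| < σ⁻¹`. -/
theorem lt_inv_envelope_iff {t σ : ℝ} (ht : 0 < t) (hσ : 0 < σ) (hσt : σ < t⁻¹) (x : ℝ) : σ < (max t |g x|)⁻¹ ↔ |g x| < σ⁻¹ := by
  have hM : 0 < max t |g x| := lt_max_of_lt_left ht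
  rw [lt_inv_comm₀ hσ hM, max_lt_iff]
  exact ⟨fun h => h.2, fun h => ⟨(lt_inv_comm₀ hσ ht).1 hσt, h⟩⟩

/-- For `σ ≥ 1/t` the superlevel set of the envelope is empty. -/
theorem not_lt_inv_envelope {t σ : ℝ} (ht : 0 < t) (hσt : t⁻¹ ≤ σ) (x : ℝ) : ¬ σ < (max t |g x|)⁻¹ :=
  not_lt.2 ((inv_envelope_le g ht x).trans hσt)

/-- `∫_{u..v} σ^{-1/2} dσ ≤ 2/√u … ` in the form needed: for `0 < u ≤ v`, `∫_{u..v} (√σ)⁻¹ dσ = 2(√v − √u)`. -/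
theorem integral_inv_sqrt {u v : ℝ} (hu : 0 < u) (huv : u ≤ v) : ∫ σ in u..v, (Real.sqrt σ)⁻¹ = 2 * (Real.sqrt v - Real.sqrt u) := by
  have h0 : (0 : ℝ) ∉ uIcc u v := by
    rw [uIcc_of_le huv]; intro h; exact absurd h.1 (not_le.2 hu)
  have key : ∫ σ in u..v, σ ^ (-(1 / 2 : ℝ)) = (v ^ (-(1 / 2 : ℝ) + 1) - u ^ (-(1 / 2 : ℝ) + 1)) / (-(1 / 2 : ℝ) + 1) :=
    integral_rpow (Or.inr ⟨by norm_num, h0⟩)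
  have hcongr : ∫ σ in u..v, (Real.sqrt σ)⁻¹ = ∫ σ in u..v, σ ^ (-(1 / 2 : ℝ)) := by
    refine integral_congr fun σ hσ => ?_
    rw [uIcc_of_le huv] at hσ
    have hσ0 : 0 ≤ σ := hu.le.trans hσ.1
    rw [Real.sqrt_eq_rpow, Real.rpow_neg hσ0]
  rw [hcongr, key]
  have e1 : (-(1 / 2 : ℝ) + 1) = 1 / 2 := by norm_num
  rw [e1, ← Real.sqrt_eq_rpow, ← Real.sqrt_eq_rpow]
  field_simp

/-- **LAYER CAKE FOR THE ENVELOPE.**  `g` continuous, `t, κ > 0`, and a distribution bound `vol{x ∈ [a,b] : |g x| < s} ≤ α·s + β·√s` for `0 < s ≤ κ/2`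
(`α, β ≥ 0`) ⟹ `∫_{[a,b]} dx/max(t,|g x|) ≤ 2(b − a)/κ + α·log⁺(κ/(2t)) + 2β/√t`.  Cavalieri: `∫ f = ∫₀^{1/t} vol{|g| < 1/σ} dσ`, the levels
`σ ≤ 2/κ` cost `≤ (b − a)` each, the levels `2/κ < σ < 1/t` cost `≤ α/σ + β/√σ`. [folklore] -/
theorem integral_inv_envelope_le_of_sublevel (hab : a ≤ b) (hgc : Continuous g) {κ t α β : ℝ} (hκ : 0 < κ) (ht : 0 < t) (hα : 0 ≤ α) (hβ : 0 ≤ β)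
    (hvol : ∀ s, 0 < s → s ≤ κ / 2 → volume {x ∈ Icc a b | |g x| < s} ≤ ENNReal.ofReal (α * s + β * Real.sqrt s)) :
    ∫ x in Icc a b, (max t |g x|)⁻¹ ≤ 2 * (b - a) / κ + α * log⁺ (κ / (2 * t)) + 2 * β / Real.sqrt t := by
  set μ : Measure ℝ := volume.restrict (Icc a b) with hμ
  haveI : IsFiniteMeasure μ := by rw [hμ]; infer_instance
  set f : ℝ → ℝ := fun x => (max t |g x|)⁻¹ with hf
  have hfc : Continuous f := continuous_inv_envelope hgc ht
  have hfi : Integrable f μ := by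
    refine ⟨hfc.aestronglyMeasurable, ?_⟩
    exact HasFiniteIntegral.of_bounded (C := t⁻¹) (Eventually.of_forall fun x => by
      rw [Real.norm_eq_abs, abs_of_nonneg (inv_envelope_nonneg g ht x)]; exact inv_envelope_le g ht x)
  have hfnn : 0 ≤ᵐ[μ] f := Eventually.of_forall fun x => inv_envelope_nonneg g ht x
  -- Cavalieri
  have hcav : ∫ x, f x ∂μ = ∫ σ in Ioi 0, μ.real {x | σ < f x} := hfi.integral_eq_integral_meas_lt hfnn
  change ∫ x, f x ∂μ ≤ _
  rw [hcav]
  -- the majorant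
  set σ₁ : ℝ := 2 / κ with hσ₁
  set σ₂ : ℝ := t⁻¹ with hσ₂
  have hσ₁0 : 0 < σ₁ := by positivity
  set M : ℝ → ℝ := fun σ => (Ioc 0 σ₁).indicator (fun _ => b - a) σ + (Ioo σ₁ σ₂).indicator (fun σ => α * σ⁻¹ + β * (Real.sqrt σ)⁻¹) σ
    with hM
  -- pointwise bound on `Ioi 0`
  have hpt : ∀ σ ∈ Ioi (0 : ℝ), μ.real {x | σ < f x} ≤ M σ := by
    intro σ hσ
    have hσ0 : 0 < σ := hσ
    have hmeas : MeasurableSet {x | σ < f x} := (isOpen_lt continuous_const hfc).measurableSet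
    have hreal : μ.real {x | σ < f x} = volume.real ({x | σ < f x} ∩ Icc a b) := by
      rw [hμ, measureReal_restrict_apply hmeas]
    by_cases h1 : σ ≤ σ₁
    · -- cheap levels: the whole interval
      have hle : μ.real {x | σ < f x} ≤ b - a := by
        rw [hreal]
        calc volume.real ({x | σ < f x} ∩ Icc a b) ≤ volume.real (Icc a b) :=
              measureReal_mono inter_subset_right (by rw [Real.volume_Icc]; exact ENNReal.ofReal_ne_top)
          _ = b - a := Real.volume_real_Icc_of_le hab
      have hM1 : M σ = (b - a) + (Ioo σ₁ σ₂).indicator (fun σ => α * σ⁻¹ + β * (Real.sqrt σ)⁻¹) σ := by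
        simp only [hM, indicator_of_mem (show σ ∈ Ioc 0 σ₁ from ⟨hσ0, h1⟩)]
      have hind : 0 ≤ (Ioo σ₁ σ₂).indicator (fun σ => α * σ⁻¹ + β * (Real.sqrt σ)⁻¹) σ := by
        refine indicator_nonneg (fun τ hτ => ?_) σ
        have hτ0 : 0 < τ := hσ₁0.trans hτ.1
        positivity
      rw [hM1]; linarith
    · push Not at h1
      by_cases h2 : σ < σ₂
      · -- intermediate levels: the distribution bound at `s = σ⁻¹`
        have hs0 : 0 < σ⁻¹ := inv_pos.2 hσ0
        have hsκ : σ⁻¹ ≤ κ / 2 := by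
          rw [inv_le_comm₀ hσ0 (by positivity)]
          have : (κ / 2)⁻¹ = σ₁ := by rw [hσ₁, inv_div]
          rw [this]; exact h1.le
        have hset : {x | σ < f x} ∩ Icc a b = {x ∈ Icc a b | |g x| < σ⁻¹} := by
          ext x
          simp only [mem_inter_iff, mem_setOf_eq, hf]
          rw [lt_inv_envelope_iff ht hσ0 h2]
          tauto
        have hv := hvol σ⁻¹ hs0 hsκ
        have hnn : 0 ≤ α * σ⁻¹ + β * Real.sqrt σ⁻¹ := by positivity
        have hle : μ.real {x | σ < f x} ≤ α * σ⁻¹ + β * (Real.sqrt σ)⁻¹ := by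
          rw [hreal, hset, measureReal_def]
          have := ENNReal.toReal_mono ENNReal.ofReal_ne_top hv
          rw [ENNReal.toReal_ofReal hnn, Real.sqrt_inv] at this
          exact this
        have hM2 : M σ = α * σ⁻¹ + β * (Real.sqrt σ)⁻¹ := by
          simp only [hM, indicator_of_notMem (show σ ∉ Ioc 0 σ₁ from fun h => (not_le.2 h1) h.2),
            indicator_of_mem (show σ ∈ Ioo σ₁ σ₂ from ⟨h1, h2⟩), zero_add]
        rw [hM2]; exact hle
      · -- expensive levels: empty superlevel set
        push Not at h2
        have hempty : {x | σ < f x} = ∅ := by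
          ext x
          simp only [mem_setOf_eq, mem_empty_iff_false, iff_false, hf]
          exact not_lt_inv_envelope ht h2 x
        have hM3 : M σ = 0 := by
          simp only [hM, indicator_of_notMem (show σ ∉ Ioc 0 σ₁ from fun h => (not_le.2 h1) h.2),
            indicator_of_notMem (show σ ∉ Ioo σ₁ σ₂ from fun h => (not_le.2 h.2) h2), add_zero]
        rw [hM3, hempty, measureReal_empty]
  -- integrability of the majorant
  have hI1 : IntegrableOn (fun _ : ℝ => b - a) (Ioc 0 σ₁) volume :=
    integrableOn_const (by rw [Real.volume_Ioc]; exact ENNReal.ofReal_ne_top)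
  have hcont2 : ContinuousOn (fun σ => α * σ⁻¹ + β * (Real.sqrt σ)⁻¹) (Icc σ₁ σ₂) := by
    refine ContinuousOn.add (ContinuousOn.mul continuousOn_const (continuousOn_inv₀.mono ?_))
      (ContinuousOn.mul continuousOn_const ((continuousOn_inv₀.comp Real.continuous_sqrt.continuousOn ?_)))
    · intro σ hσ; exact (hσ₁0.trans_le hσ.1).ne'
    · intro σ hσ; simp only [mem_compl_iff, mem_singleton_iff]; exact (Real.sqrt_pos.2 (hσ₁0.trans_le hσ.1)).ne'
  have hI2 : IntegrableOn (fun σ => α * σ⁻¹ + β * (Real.sqrt σ)⁻¹) (Ioo σ₁ σ₂) volume :=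
    (hcont2.integrableOn_Icc).mono_set Ioo_subset_Icc_self
  have hMi : Integrable M (volume.restrict (Ioi 0)) := by
    refine Integrable.add ?_ ?_
    · exact ((hI1.integrable_indicator measurableSet_Ioc).restrict)
    · exact ((hI2.integrable_indicator measurableSet_Ioo).restrict)
  -- compare
  have hcmp : ∫ σ in Ioi 0, μ.real {x | σ < f x} ≤ ∫ σ in Ioi 0, M σ := by
    refine integral_mono_of_nonneg (Eventually.of_forall fun σ => measureReal_nonneg) hMi ?_
    exact (ae_restrict_iff' measurableSet_Ioi).2 (Eventually.of_forall hpt)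
  refine hcmp.trans ?_
  -- evaluate the majorant
  have hsub1 : Ioc 0 σ₁ ⊆ Ioi 0 := fun σ hσ => hσ.1
  have hsub2 : Ioo σ₁ σ₂ ⊆ Ioi 0 := fun σ hσ => hσ₁0.trans hσ.1
  have hE1 : ∫ σ in Ioi 0, (Ioc 0 σ₁).indicator (fun _ => b - a) σ = (b - a) * σ₁ := by
    rw [MeasureTheory.integral_indicator measurableSet_Ioc, Measure.restrict_restrict measurableSet_Ioc, inter_eq_left.2 hsub1,
      setIntegral_const, Real.volume_real_Ioc_of_le hσ₁0.le, sub_zero, smul_eq_mul, mul_comm]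
  have hE2 : ∫ σ in Ioi 0, (Ioo σ₁ σ₂).indicator (fun σ => α * σ⁻¹ + β * (Real.sqrt σ)⁻¹) σ ≤
      α * log⁺ (κ / (2 * t)) + 2 * β / Real.sqrt t := by
    rw [MeasureTheory.integral_indicator measurableSet_Ioo, Measure.restrict_restrict measurableSet_Ioo, inter_eq_left.2 hsub2]
    by_cases h12 : σ₁ < σ₂
    · rw [← integral_Ioc_eq_integral_Ioo, ← intervalIntegral.integral_of_le h12.le]
      have hi1 : IntervalIntegrable (fun σ => α * σ⁻¹) volume σ₁ σ₂ := by
        refine (ContinuousOn.mul continuousOn_const (continuousOn_inv₀.mono ?_)).intervalIntegrable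
        intro σ hσ; rw [uIcc_of_le h12.le] at hσ; exact (hσ₁0.trans_le hσ.1).ne'
      have hi2 : IntervalIntegrable (fun σ => β * (Real.sqrt σ)⁻¹) volume σ₁ σ₂ := by
        refine (ContinuousOn.mul continuousOn_const ((continuousOn_inv₀.comp Real.continuous_sqrt.continuousOn ?_))).intervalIntegrable
        intro σ hσ; rw [uIcc_of_le h12.le] at hσ
        simp only [mem_compl_iff, mem_singleton_iff]; exact (Real.sqrt_pos.2 (hσ₁0.trans_le hσ.1)).ne'
      rw [intervalIntegral.integral_add hi1 hi2, intervalIntegral.integral_const_mul, intervalIntegral.integral_const_mul,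
        integral_inv_of_pos hσ₁0 (hσ₁0.trans h12), integral_inv_sqrt hσ₁0 h12.le]
      have hlog : Real.log (σ₂ / σ₁) ≤ log⁺ (κ / (2 * t)) := by
        have : σ₂ / σ₁ = κ / (2 * t) := by rw [hσ₂, hσ₁]; field_simp
        rw [this, Real.posLog_apply]; exact le_max_right _ _
      have hsq : 2 * (Real.sqrt σ₂ - Real.sqrt σ₁) ≤ 2 / Real.sqrt t := by
        have h1 : Real.sqrt σ₂ = (Real.sqrt t)⁻¹ := by rw [hσ₂, Real.sqrt_inv]
        rw [h1]
        have := Real.sqrt_nonneg σ₁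
        rw [div_eq_mul_inv]; linarith
      calc α * Real.log (σ₂ / σ₁) + β * (2 * (Real.sqrt σ₂ - Real.sqrt σ₁))
          ≤ α * log⁺ (κ / (2 * t)) + β * (2 / Real.sqrt t) := add_le_add (mul_le_mul_of_nonneg_left hlog hα) (mul_le_mul_of_nonneg_left hsq hβ)
        _ = α * log⁺ (κ / (2 * t)) + 2 * β / Real.sqrt t := by ring
    · push Not at h12
      rw [Ioo_eq_empty (not_lt.2 h12), Measure.restrict_empty, integral_zero_measure]
      exact add_nonneg (mul_nonneg hα Real.posLog_nonneg) (by positivity)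
  rw [integral_add ((hI1.integrable_indicator measurableSet_Ioc).restrict) ((hI2.integrable_indicator measurableSet_Ioo).restrict), hE1]
  have e1 : (b - a) * σ₁ = 2 * (b - a) / κ := by rw [hσ₁]; ring
  rw [e1]
  linarith

/-- **THE ENVELOPE INTEGRAL UNDER THE FIRST-ORDER DICHOTOMY.**  `g ∈ C¹` on `[a,b]`, slope ceiling `L₁`, dichotomy `|g| ≤ κ → c₁ ≤ |g′|`, `N` cells
(`(b − a)·2L₁ ≤ N·κ`), `t > 0` ⟹ `∫_{[a,b]} dx/max(t,|g x|) ≤ 2(b − a)/κ + (2N/c₁)·log⁺(κ/(2t))`: the level region `|g| ≥ κ/2` costs `2/κ` per unit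
length, each crossing cell costs one logarithm of `κ/t`. [cite: Salmhofer1999, §4.5.3 Lemma 4.10; FeldmanSalmhoferTrubowitz1998, §3] -/
theorem integral_inv_envelope_le_of_dichotomy_one (hab : a ≤ b) (hg : ContDiff ℝ 1 g) {κ c₁ L₁ t : ℝ} {N : ℕ} (hκ : 0 < κ) (hc₁ : 0 < c₁)
    (hL₁ : 0 < L₁) (hL : ∀ x ∈ Icc a b, |deriv g x| ≤ L₁) (hdich : ∀ x ∈ Icc a b, |g x| ≤ κ → c₁ ≤ |deriv g x|)
    (hN : (b - a) * (2 * L₁) ≤ N * κ) (ht : 0 < t) :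
    ∫ x in Icc a b, (max t |g x|)⁻¹ ≤ 2 * (b - a) / κ + N * (2 / c₁) * log⁺ (κ / (2 * t)) := by
  have h := integral_inv_envelope_le_of_sublevel hab hg.continuous hκ ht (α := N * (2 / c₁)) (β := 0) (by positivity) le_rfl ?_
  · simpa using h
  · intro s hs0 hs
    have hv := volume_sublevel_Icc_le_of_dichotomy_one hab hg hκ hc₁ hL₁ hL hdich hN hs
    refine hv.trans (le_of_eq ?_)
    rw [zero_mul, add_zero, show (N : ℝ) * (2 / c₁) * s = N * (2 * s / c₁) by ring,
      ENNReal.ofReal_mul (Nat.cast_nonneg N), ENNReal.ofReal_natCast]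

/-- **THE ENVELOPE INTEGRAL UNDER THE SECOND-ORDER DICHOTOMY.**  `g ∈ C²` on `[a,b]`, ceilings `L₁, L₂`, dichotomy `|g| ≤ κ → |g′| < c₁ → c₂ ≤ |g″|`, `N`
cells (`(b − a)·2L₁ ≤ N·κ`, `(b − a)·4L₂ ≤ N·c₁`), `t > 0` ⟹
`∫_{[a,b]} dx/max(t,|g x|) ≤ 2(b − a)/κ + (4N/c₁)·log⁺(κ/(2t)) + 12N/√(c₂·t)` — transversal cells cost a logarithm, fold cells (tangency, umklapp
caustic) cost `t^{−1/2}`, both integrable against the level. [cite: Salmhofer1999, §4.5.3 Lemma 4.10; FeldmanSalmhoferTrubowitz1998, §3] -/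
theorem integral_inv_envelope_le_of_dichotomy_two (hab : a ≤ b) (hg : ContDiff ℝ 2 g) {κ c₁ c₂ L₁ L₂ t : ℝ} {N : ℕ} (hκ : 0 < κ) (hc₁ : 0 < c₁)
    (hc₂ : 0 < c₂) (hL₁ : 0 < L₁) (hL₂ : 0 < L₂) (hL : ∀ x ∈ Icc a b, |deriv g x| ≤ L₁) (hL' : ∀ x ∈ Icc a b, |iteratedDeriv 2 g x| ≤ L₂)
    (hdich : ∀ x ∈ Icc a b, |g x| ≤ κ → |deriv g x| < c₁ → c₂ ≤ |iteratedDeriv 2 g x|)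
    (hN : (b - a) * (2 * L₁) ≤ N * κ) (hN' : (b - a) * (4 * L₂) ≤ N * c₁) (ht : 0 < t) :
    ∫ x in Icc a b, (max t |g x|)⁻¹ ≤ 2 * (b - a) / κ + N * (4 / c₁) * log⁺ (κ / (2 * t)) + 12 * N / Real.sqrt (c₂ * t) := by
  have hsc : 0 < Real.sqrt c₂ := Real.sqrt_pos.2 hc₂
  have h := integral_inv_envelope_le_of_sublevel hab hg.continuous hκ ht (α := N * (4 / c₁)) (β := N * (6 / Real.sqrt c₂))
    (by positivity) (by positivity) ?_
  · refine h.trans (le_of_eq ?_)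
    rw [Real.sqrt_mul hc₂.le]
    field_simp
    ring
  · intro s hs0 hs
    have hv := volume_sublevel_Icc_le_of_dichotomy_two hab hg hκ hc₁ hc₂ hL₁ hL₂ hL hL' hdich hN hN' hs0 hs
    refine hv.trans (le_of_eq ?_)
    rw [show (N : ℝ) * (4 / c₁) * s + N * (6 / Real.sqrt c₂) * Real.sqrt s = N * (4 * s / c₁ + 6 * Real.sqrt (s / c₂)) by
      rw [Real.sqrt_div hs0.le]; ring,
      ENNReal.ofReal_mul (Nat.cast_nonneg N), ENNReal.ofReal_natCast]

/-- Interval-integral form of `integral_inv_envelope_le_of_dichotomy_one` (`∫ x in a..b`). -/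
theorem intervalIntegral_inv_envelope_le_of_dichotomy_one (hab : a ≤ b) (hg : ContDiff ℝ 1 g) {κ c₁ L₁ t : ℝ} {N : ℕ} (hκ : 0 < κ)
    (hc₁ : 0 < c₁) (hL₁ : 0 < L₁) (hL : ∀ x ∈ Icc a b, |deriv g x| ≤ L₁) (hdich : ∀ x ∈ Icc a b, |g x| ≤ κ → c₁ ≤ |deriv g x|)
    (hN : (b - a) * (2 * L₁) ≤ N * κ) (ht : 0 < t) :
    ∫ x in a..b, (max t |g x|)⁻¹ ≤ 2 * (b - a) / κ + N * (2 / c₁) * log⁺ (κ / (2 * t)) := by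
  rw [intervalIntegral.integral_of_le hab, ← integral_Icc_eq_integral_Ioc]
  exact integral_inv_envelope_le_of_dichotomy_one hab hg hκ hc₁ hL₁ hL hdich hN ht

/-- Interval-integral form of `integral_inv_envelope_le_of_dichotomy_two` (`∫ x in a..b`). -/
theorem intervalIntegral_inv_envelope_le_of_dichotomy_two (hab : a ≤ b) (hg : ContDiff ℝ 2 g) {κ c₁ c₂ L₁ L₂ t : ℝ} {N : ℕ} (hκ : 0 < κ)
    (hc₁ : 0 < c₁) (hc₂ : 0 < c₂) (hL₁ : 0 < L₁) (hL₂ : 0 < L₂) (hL : ∀ x ∈ Icc a b, |deriv g x| ≤ L₁)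
    (hL' : ∀ x ∈ Icc a b, |iteratedDeriv 2 g x| ≤ L₂) (hdich : ∀ x ∈ Icc a b, |g x| ≤ κ → |deriv g x| < c₁ → c₂ ≤ |iteratedDeriv 2 g x|)
    (hN : (b - a) * (2 * L₁) ≤ N * κ) (hN' : (b - a) * (4 * L₂) ≤ N * c₁) (ht : 0 < t) :
    ∫ x in a..b, (max t |g x|)⁻¹ ≤ 2 * (b - a) / κ + N * (4 / c₁) * log⁺ (κ / (2 * t)) + 12 * N / Real.sqrt (c₂ * t) := by
  rw [intervalIntegral.integral_of_le hab, ← integral_Icc_eq_integral_Ioc]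
  exact integral_inv_envelope_le_of_dichotomy_two hab hg hκ hc₁ hc₂ hL₁ hL₂ hL hL' hdich hN hN' ht

end LayerCake

end Summit.HubbardSuperconductivity.HubbardSuperconductivity.Theorems.C4a

end
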